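import Literature.Analysis.FluidPDE.TaoH1FourierMild
import Literature.Analysis.FluidPDE.FourierL2Trajectory
import Literature.Analysis.FluidPDE.NSRegFourierFamily
import Literature.Analysis.FluidPDE.NSFourierTimeRegularity
import HarnessLib

/-!
# Fourier-side `H¹`-mild solutions of Sobolev class: envelopes, the differential equation and
# the time-derivative families

First file of the discharge of `Literature.Analysis.FluidPDE.sobolevMild_classical`
(`TaoH1FourierMild.lean`: T. Tao, Anal. PDE 6 (2013) = arXiv:1108.1165, Thm. 5.4 (iv) with (i),
run on the Fourier side). For a heat rate `c ≥ 0`, a datum `a` of Sobolev class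
(`IsSobolevFourierDatum a`: all weighted square moments finite) and a Fourier-side mild solution
`v` (`IsSobolevMild c T a v`: fixed point of the clamped Duhamel map with pointwise decay of every
order of its Duhamel part) we prove:

* `IsSobolevMild.exists_dom` — **square-integrable envelopes of every order**, uniformly in time:
  `(1 + ‖ξ‖)^K ‖v(t, ξ)ₗ‖ ≤ G_K(ξ)` with `G_K ∈ L²` (the heat part is dominated by the datum, the
  Duhamel part decays pointwise); hence square integrability and `L²`-continuity in time of the
  components (`memLp_apply`, `tendsto_eLpNorm_sub`, dominated convergence) and joint continuity of
  the nonlinearity `(s, ξ) ↦ N(v s, v s)(ξ)` (`continuous_nonlin`, from `FourierL2Trajectory`);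
* `IsSobolevMild.hasDerivWithinAt` — **mild ⇒ differential**: at every frequency and every
  `t ∈ [0, T]`, `∂ₜ v(t, ξ) = -c‖ξ‖² v(t, ξ) − N(v(t), v(t))(ξ)` within `[0, T]` (the computation
  `e^{-βt}(a − ∫₀ᵗ e^{βs} N ds)` and the fundamental theorem of calculus, as in the tree's
  `PicardHyp.hasDerivWithinAt_limit` for the pointwise class);
* `IsSobolevMild.exists_family` — **time derivatives of all orders**: for every `n` there is a
  vector family `W₀ = v, W₁, …, W_n` whose components are square-dominated Fourier families
  (`IsDomFamily`, `NSRegFourierFamily`) with `∂ₜ W_k = W_{k+1}` within `[0, T]`, built by the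
  bootstrap `W_{k+1} = -c‖ξ‖² W_k − N(W, W)_k` (closure of square-dominated families under symbols
  and under the nonlinearity, `IsDomFamily.nonlinFamily`); and the pressure-symbol family
  (`exists_presFamily`).

These are the inputs of the synthesis `u(t) = Re 𝓕 v(t)` on the closed slab (joint smoothness,
the equations, the Sobolev bounds) in the sequel files; on the physical side they are Tao's
"`∂ₜʲ u ∈ L^∞_t H^k_x` for all `j, k`" (arXiv p. 18) for the `H¹` mild solution with `H^∞` datum
(Leray 1934, §19, pp. 220–221 for the regular solution).

## Mathlib / tree search

Reused: `IsDomFamily` and its algebra (`NSRegFourierFamily`), `tendsto_eLpNorm_sub_of_dominated`,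
`continuous_nonlin_of_tendsto`, `continuous_presSymbol_time_of_tendsto` (`FourierL2Trajectory`),
`consFamily`, `norm_heatSymbol_le` (`NSFourierTimeRegularity`), `memLp_inv_one_add_norm_pow_two`
(`NSRegFourierFamily`). Mathlib: `Continuous.integral_hasStrictDerivAt`, `HasDerivAt.smul`.

## References

* T. Tao, arXiv:1108.1165 = Anal. PDE 6 (2013), Thm. 5.4 = arXiv Thm. 31 (p. 18), (iv) and the
  note closing its proof. [Tao2011]
* J. Leray, Acta Math. 63 (1934), §19, pp. 220–221. [Leray1934]
-/

noncomputable section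

open MeasureTheory Real Set Filter Function Complex
open scoped ENNReal NNReal ComplexConjugate
open _root_.Topology

namespace Literature.Analysis.FluidPDE.FourierNS

variable {ι : Type*} [Fintype ι] [DecidableEq ι]
variable {c T : ℝ} {a : EuclideanSpace ℝ ι → ι → ℂ} {v : ℝ → EuclideanSpace ℝ ι → ι → ℂ}

/-! ### The datum: square-integrable weighted components -/

omit [DecidableEq ι] in
/-- A component of a datum of Sobolev class with the weight `(1 + ‖ξ‖)^k` is square integrable:
`ξ ↦ (1 + ‖ξ‖)^k ‖a ξ l‖ ∈ L²`. [folklore] -/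
theorem IsSobolevFourierDatum.memLp_weight_mul_norm (ha : IsSobolevFourierDatum a) (k : ℕ) (l : ι) :
    MemLp (fun ξ : EuclideanSpace ℝ ι => (1 + ‖ξ‖) ^ k * ‖a ξ l‖) 2 volume := by
  have hmeas : AEStronglyMeasurable (fun ξ : EuclideanSpace ℝ ι => (1 + ‖ξ‖) ^ k * ‖a ξ l‖) volume :=
    (Continuous.aestronglyMeasurable (by fun_prop)).mul
      ((continuous_apply l).comp_aestronglyMeasurable ha.meas).norm
  refine ⟨hmeas, ?_⟩
  have hsq : ∫⁻ ξ, ‖(1 + ‖ξ‖) ^ k * ‖a ξ l‖‖ₑ ^ 2 < ⊤ := by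
    refine lt_of_le_of_lt (lintegral_mono fun ξ => ?_) (ha.moments k)
    have h0 : 0 ≤ (1 + ‖ξ‖) ^ k := by positivity
    rw [Real.enorm_eq_ofReal (by positivity), ENNReal.ofReal_mul h0, ofReal_norm, mul_pow,
      ← ENNReal.ofReal_pow h0, ← pow_mul, mul_comm k 2]
    gcongr
    exact Finset.single_le_sum (f := fun l => ‖a ξ l‖ₑ ^ 2) (fun _ _ => zero_le)
      (Finset.mem_univ l)
  rw [lintegral_enorm_sq_eq_eLpNorm_sq] at hsq
  exact lt_of_pow_lt_pow_left' 2 (hsq.trans_eq (ENNReal.top_pow (n := 2) two_ne_zero).symm)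

/-! ### Envelopes of the mild solution -/

section Envelope

omit [DecidableEq ι] in
/-- The pointwise decomposition `v(t, ξ)ₗ = heat · a(ξ)ₗ + (v(t, ξ) − heat • a(ξ))ₗ` gives
`‖v(t, ξ)ₗ‖ ≤ ‖a(ξ)ₗ‖ + ‖v(t, ξ) − heat • a(ξ)‖` for `c ≥ 0`. [folklore] -/
theorem norm_apply_le_norm_add_norm_sub_heat (hc : 0 ≤ c) (t : ℝ)
    (ξ : EuclideanSpace ℝ ι) (l : ι) :
    ‖v t ξ l‖ ≤ ‖a ξ l‖ + ‖v t ξ - heat c ξ (clamp T t) • a ξ‖ := by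
  have h1 : v t ξ l = (heat c ξ (clamp T t) • a ξ) l + (v t ξ - heat c ξ (clamp T t) • a ξ) l := by
    simp
  have h2 : ‖(heat c ξ (clamp T t) • a ξ) l‖ ≤ ‖a ξ l‖ := by
    rw [Pi.smul_apply, norm_smul, Real.norm_of_nonneg (heat_nonneg _ _ _)]
    exact mul_le_of_le_one_left (norm_nonneg _) (heat_clamp_le_one hc T t ξ)
  calc ‖v t ξ l‖ = ‖(heat c ξ (clamp T t) • a ξ) l + (v t ξ - heat c ξ (clamp T t) • a ξ) l‖ := by
        rw [← h1]
    _ ≤ ‖(heat c ξ (clamp T t) • a ξ) l‖ + ‖(v t ξ - heat c ξ (clamp T t) • a ξ) l‖ := norm_add_le _ _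
    _ ≤ ‖a ξ l‖ + ‖v t ξ - heat c ξ (clamp T t) • a ξ‖ := add_le_add h2 (norm_le_pi_norm _ l)

/-- **Square-integrable envelopes of every order, uniformly in time.** For `c ≥ 0`, a datum of
Sobolev class and an `IsSobolevMild` solution: for every `K` and every component `l` there is
`G ∈ L²(E)` with `(1 + ‖ξ‖)^K ‖v(t, ξ)ₗ‖ ≤ G(ξ)` for all `t` and `ξ`
(`G = (1+‖ξ‖)^K ‖aₗ‖ + B_{K+K₀} (1+‖ξ‖)^{-K₀}`, `K₀ = card ι + 1`). [folklore] -/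
theorem IsSobolevMild.exists_dom (h : IsSobolevMild c T a v) (hc : 0 ≤ c)
    (ha : IsSobolevFourierDatum a) (K : ℕ) (l : ι) :
    ∃ G : EuclideanSpace ℝ ι → ℝ, MemLp G 2 volume ∧
      ∀ t ξ, (1 + ‖ξ‖) ^ K * ‖v t ξ l‖ ≤ G ξ := by
  set K₀ := Fintype.card ι + 1 with hK₀
  obtain ⟨B, hB⟩ := h.decay (K + K₀)
  have hB0 : 0 ≤ B := le_trans (by positivity) (hB 0 0)
  refine ⟨fun ξ => (1 + ‖ξ‖) ^ K * ‖a ξ l‖ + B * ((1 + ‖ξ‖) ^ K₀)⁻¹, ?_, fun t ξ => ?_⟩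
  · exact (ha.memLp_weight_mul_norm K l).add
      ((memLp_inv_one_add_norm_pow_two (ι := ι)).const_mul B)
  · have hpos : 0 < (1 + ‖ξ‖) ^ K₀ := by positivity
    have hdec : (1 + ‖ξ‖) ^ K * ‖v t ξ - heat c ξ (clamp T t) • a ξ‖ ≤ B * ((1 + ‖ξ‖) ^ K₀)⁻¹ := by
      rw [le_mul_inv_iff₀ hpos]
      calc (1 + ‖ξ‖) ^ K * ‖v t ξ - heat c ξ (clamp T t) • a ξ‖ * (1 + ‖ξ‖) ^ K₀
          = (1 + ‖ξ‖) ^ (K + K₀) * ‖v t ξ - heat c ξ (clamp T t) • a ξ‖ := by rw [pow_add]; ring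
        _ ≤ B := hB t ξ
    calc (1 + ‖ξ‖) ^ K * ‖v t ξ l‖
        ≤ (1 + ‖ξ‖) ^ K * (‖a ξ l‖ + ‖v t ξ - heat c ξ (clamp T t) • a ξ‖) :=
          mul_le_mul_of_nonneg_left (norm_apply_le_norm_add_norm_sub_heat hc t ξ l) (by positivity)
      _ = (1 + ‖ξ‖) ^ K * ‖a ξ l‖ + (1 + ‖ξ‖) ^ K * ‖v t ξ - heat c ξ (clamp T t) • a ξ‖ := by ring
      _ ≤ (1 + ‖ξ‖) ^ K * ‖a ξ l‖ + B * ((1 + ‖ξ‖) ^ K₀)⁻¹ := add_le_add le_rfl hdec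

/-- Measurability of a component slice. [folklore] -/
theorem IsSobolevMild.aesm_apply (h : IsSobolevMild c T a v) (t : ℝ) (l : ι) :
    AEStronglyMeasurable (fun ξ => v t ξ l) volume :=
  (continuous_apply l).comp_aestronglyMeasurable (h.meas t)

/-- **The components of the solution form square-dominated families of order `0`.** [folklore] -/
theorem IsSobolevMild.isDomFamily_zero (h : IsSobolevMild c T a v) (hc : 0 ≤ c)
    (ha : IsSobolevFourierDatum a) (l : ι) :
    IsDomFamily T 0 (fun _ t ξ => v t ξ l) where
  meas _ _ t _ := h.aesm_apply t l
  dom _ _ K := by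
    obtain ⟨G, hG, hle⟩ := h.exists_dom hc ha K l
    exact ⟨G, hG, fun t _ ξ => hle t ξ⟩
  cont _ _ ξ := ((continuous_apply l).comp (h.cont ξ)).continuousOn
  deriv k hk := absurd hk (Nat.not_lt_zero k)

/-- **Components of the solution are square integrable** at every time. [folklore] -/
theorem IsSobolevMild.memLp_apply (h : IsSobolevMild c T a v) (hc : 0 ≤ c)
    (ha : IsSobolevFourierDatum a) (t : ℝ) (l : ι) : MemLp (v t · l) 2 volume := by
  obtain ⟨G, hG, hle⟩ := h.exists_dom hc ha 0 l
  refine MemLp.of_le (hG.norm) (h.aesm_apply t l) (Eventually.of_forall fun ξ => ?_)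
  have := hle t ξ
  rw [pow_zero, one_mul] at this
  rw [norm_norm, Real.norm_eq_abs, abs_of_nonneg ((norm_nonneg _).trans this)]
  exact this

/-- **`L²`-continuity in time of the components** (dominated convergence: pointwise continuity in
`t` and the square-integrable envelope of order `0`). [folklore] -/
theorem IsSobolevMild.tendsto_eLpNorm_sub (h : IsSobolevMild c T a v) (hc : 0 ≤ c)
    (ha : IsSobolevFourierDatum a) (l : ι) (s₀ : ℝ) :
    Tendsto (fun s => eLpNorm ((v s · l) - (v s₀ · l)) 2 volume) (𝓝 s₀) (𝓝 0) := by
  obtain ⟨G, hG, hle⟩ := h.exists_dom hc ha 0 l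
  have hfin : ∫⁻ η, ‖G η‖ₑ ^ 2 ≠ ⊤ := by
    rw [lintegral_enorm_sq_eq_eLpNorm_sq]
    exact (ENNReal.pow_lt_top hG.eLpNorm_lt_top).ne
  refine tendsto_eLpNorm_sub_of_dominated (G := fun s => (v s · l)) (fun s => h.aesm_apply s l)
    (fun η => ‖G η‖ₑ) (fun s η => ?_) hfin (fun η => (continuous_apply l).comp (h.cont η)) s₀
  have h1 := hle s η
  rw [pow_zero, one_mul] at h1
  rw [← ofReal_norm, ← ofReal_norm, Real.norm_eq_abs, abs_of_nonneg ((norm_nonneg _).trans h1)]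
  exact ENNReal.ofReal_le_ofReal h1

/-- **Joint continuity of the nonlinearity** `(s, ξ) ↦ N(v s, v s)(ξ)` on `ℝ × E`
(`continuous_nonlin_of_tendsto` of `FourierL2Trajectory`). [folklore] -/
theorem IsSobolevMild.continuous_nonlin (h : IsSobolevMild c T a v) (hc : 0 ≤ c)
    (ha : IsSobolevFourierDatum a) :
    Continuous fun p : ℝ × EuclideanSpace ℝ ι => nonlin (v p.1) (v p.1) p.2 :=
  continuous_nonlin_of_tendsto (fun s j => h.memLp_apply hc ha s j) (fun s j => h.memLp_apply hc ha s j)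
    (fun j s₀ => h.tendsto_eLpNorm_sub hc ha j s₀) (fun j s₀ => h.tendsto_eLpNorm_sub hc ha j s₀)

/-- Continuity in time of the nonlinearity at a fixed frequency. [folklore] -/
theorem IsSobolevMild.continuous_nonlin_time (h : IsSobolevMild c T a v) (hc : 0 ≤ c)
    (ha : IsSobolevFourierDatum a) (ξ : EuclideanSpace ℝ ι) :
    Continuous fun s : ℝ => nonlin (v s) (v s) ξ :=
  (h.continuous_nonlin hc ha).comp₂ continuous_id continuous_const

/-- Continuity in time of the pressure symbol at a fixed frequency. [folklore] -/
theorem IsSobolevMild.continuous_presSymbol_time (h : IsSobolevMild c T a v) (hc : 0 ≤ c)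
    (ha : IsSobolevFourierDatum a) (ξ : EuclideanSpace ℝ ι) :
    Continuous fun s : ℝ => presSymbol (v s) (v s) ξ :=
  continuous_presSymbol_time_of_tendsto (fun s j => h.memLp_apply hc ha s j)
    (fun s j => h.memLp_apply hc ha s j) (fun j s₀ => h.tendsto_eLpNorm_sub hc ha j s₀)
    (fun j s₀ => h.tendsto_eLpNorm_sub hc ha j s₀) ξ

end Envelope

/-! ### Mild ⇒ differential -/

section Mild

/-- **Mild ⇒ differential.** An `IsSobolevMild` solution satisfies, at every frequency and every
`t ∈ [0, T]`, `∂ₜ v(t, ξ) = -c‖ξ‖² v(t, ξ) − N(v(t), v(t))(ξ)` as a derivative within `[0, T]`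
(differentiate `v(t) = e^{-βt} a − e^{-βt} ∫₀ᵗ e^{βs} N(s) ds`, `β = c‖ξ‖²`, by the product rule
and the fundamental theorem of calculus, `N(·)(ξ)` being continuous in time; Leray 1934, §19;
Lemarié-Rieusset 2016, §8.5, equivalence of mild and differential formulations). [folklore] -/
theorem IsSobolevMild.hasDerivWithinAt (h : IsSobolevMild c T a v) (hc : 0 ≤ c)
    (ha : IsSobolevFourierDatum a) (ξ : EuclideanSpace ℝ ι) {t : ℝ} (ht : t ∈ Icc 0 T) :
    HasDerivWithinAt (fun s => v s ξ) (-(c * ‖ξ‖ ^ 2) • v t ξ - nonlin (v t) (v t) ξ) (Icc 0 T) t := by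
  set β := c * ‖ξ‖ ^ 2 with hβ
  set N : ℝ → ι → ℂ := fun s => nonlin (v s) (v s) ξ with hN
  have hNc : Continuous N := h.continuous_nonlin_time hc ha ξ
  -- `G s = ∫₀ˢ e^{βσ} N(σ) dσ` and its derivative
  set G : ℝ → ι → ℂ := fun s => ∫ σ in (0 : ℝ)..s, Real.exp (β * σ) • N σ with hG
  have hGi : Continuous fun σ => Real.exp (β * σ) • N σ :=
    (Real.continuous_exp.comp (continuous_const.mul continuous_id)).smul hNc
  have hG' : ∀ s, HasDerivAt G (Real.exp (β * s) • N s) s := fun s =>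
    (hGi.integral_hasStrictDerivAt 0 s).hasDerivAt
  have hheat : ∀ s, heat c ξ s = Real.exp (-β * s) := fun s => by simp [heat, hβ]
  have hE' : ∀ s, HasDerivAt (fun s => Real.exp (-β * s)) (-β * Real.exp (-β * s)) s := fun s => by
    have := ((hasDerivAt_id s).const_mul (-β)).exp
    simpa [mul_comm] using this
  -- `F s = e^{-βs} a − e^{-βs} G s` is the Duhamel formula
  set F : ℝ → ι → ℂ := fun s => Real.exp (-β * s) • a ξ - Real.exp (-β * s) • G s with hF
  have hF' : ∀ s, HasDerivAt F (-β • F s - N s) s := by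
    intro s
    have h1 : HasDerivAt (fun s => Real.exp (-β * s) • a ξ) ((-β * Real.exp (-β * s)) • a ξ) s :=
      (hE' s).smul_const _
    have h2 : HasDerivAt (fun s => Real.exp (-β * s) • G s)
        (Real.exp (-β * s) • (Real.exp (β * s) • N s) + (-β * Real.exp (-β * s)) • G s) s :=
      (hE' s).smul (hG' s)
    have h3 := h1.sub h2
    have hone : Real.exp (-β * s) * Real.exp (β * s) = 1 := by
      rw [← Real.exp_add]; simp
    have heq : (-β * Real.exp (-β * s)) • a ξ -
        (Real.exp (-β * s) • (Real.exp (β * s) • N s) + (-β * Real.exp (-β * s)) • G s) =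
        -β • F s - N s := by
      simp only [hF, smul_sub, smul_smul, hone, one_smul]
      module
    rw [heq] at h3
    exact h3
  -- on `[0, T]`, `v s ξ = F s`
  have hvF : ∀ s ∈ Icc 0 T, v s ξ = F s := by
    intro s hs
    rw [h.fixed s ξ, duhamel, clamp_of_mem hs, hheat]
    have hint : (∫ σ in (0 : ℝ)..s, heat c ξ (s - σ) • nonlin (v σ) (v σ) ξ) =
        Real.exp (-β * s) • G s := by
      simp only [hG]
      rw [← intervalIntegral.integral_smul]
      refine intervalIntegral.integral_congr fun σ _ => ?_
      change heat c ξ (s - σ) • N σ = Real.exp (-β * s) • (Real.exp (β * σ) • N σ)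
      rw [hheat, smul_smul, ← Real.exp_add]
      congr 1; ring_nf
    rw [hint]
  have key := (hF' t).hasDerivWithinAt (s := Icc 0 T)
  rw [← hvF t ht] at key
  exact key.congr (fun s hs => hvF s hs) (hvF t ht)

/-- Componentwise form of `IsSobolevMild.hasDerivWithinAt`. [folklore] -/
theorem IsSobolevMild.hasDerivWithinAt_apply (h : IsSobolevMild c T a v) (hc : 0 ≤ c)
    (ha : IsSobolevFourierDatum a) (ξ : EuclideanSpace ℝ ι) {t : ℝ} (ht : t ∈ Icc 0 T) (l : ι) :
    HasDerivWithinAt (fun s => v s ξ l)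
      (-((c * ‖ξ‖ ^ 2 : ℝ) : ℂ) * v t ξ l - nonlin (v t) (v t) ξ l) (Icc 0 T) t := by
  have := hasDerivWithinAt_pi.1 (h.hasDerivWithinAt hc ha ξ ht) l
  simpa [Complex.real_smul] using this

end Mild

/-! ### The bootstrap: square-dominated families of all orders -/

section Bootstrap

/-- **Time-derivative families of all orders.** For `c ≥ 0`, `T > 0`, a datum of Sobolev class
and an `IsSobolevMild` solution `v`: for every `n` there is a vector family `W₀ = v, W₁, …, W_n`
all of whose components are square-dominated Fourier families of order `n` on `[0, T]`
(`∂ₜ W_k = W_{k+1}` within `[0, T]`, square-integrable envelopes of every order, measurable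
slices, time continuity): induction on `n` via `∂ₜ v = -c‖ξ‖² v − N(v, v)` and the closure of
square-dominated families under the heat symbol and the nonlinearity (Leray 1934, pp. 220–221;
Tao 2011, Thm. 5.4 (iv): `∂ₜʲ u ∈ L^∞_t H^k_x` for all `j, k`). [folklore] -/
theorem IsSobolevMild.exists_family (h : IsSobolevMild c T a v) (hc : 0 ≤ c) (hT : 0 < T)
    (ha : IsSobolevFourierDatum a) (n : ℕ) :
    ∃ W : ℕ → ℝ → EuclideanSpace ℝ ι → ι → ℂ, W 0 = v ∧
      ∀ l, IsDomFamily T n (fun k t ξ => W k t ξ l) := by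
  have base : ∀ l, IsDomFamily T 0 (fun _ t ξ => v t ξ l) := fun l => h.isDomFamily_zero hc ha l
  induction n with
  | zero => exact ⟨fun _ => v, rfl, base⟩
  | succ n ih =>
    obtain ⟨W, hW0, hW⟩ := ih
    -- the right-hand side family `D_k = -c‖ξ‖² W_k − N(W, W)_k`
    set D : ℕ → ℝ → EuclideanSpace ℝ ι → ι → ℂ := fun k t ξ l =>
      -((c * ‖ξ‖ ^ 2 : ℝ) : ℂ) * W k t ξ l - nonlinFamily W W k t ξ l with hD
    have hD_fam : ∀ l, IsDomFamily T n (fun k t ξ => D k t ξ l) := fun l => by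
      have h1 : IsDomFamily T n (fun k t ξ => -((c * ‖ξ‖ ^ 2 : ℝ) : ℂ) * W k t ξ l) :=
        (hW l).symbol (m := fun ξ => -((c * ‖ξ‖ ^ 2 : ℝ) : ℂ))
          (by fun_prop : Continuous fun ξ : EuclideanSpace ℝ ι =>
            -((c * ‖ξ‖ ^ 2 : ℝ) : ℂ)).aestronglyMeasurable (d := 2) (M := c) hc
          (norm_heatSymbol_le hc)
      have h2 : IsDomFamily T n (fun k t ξ => nonlinFamily W W k t ξ l) :=
        (IsDomFamily.nonlinFamily hT hW hW l).isDomFamily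
      exact h1.sub h2
    refine ⟨consFamily v D, rfl, fun l => ?_⟩
    refine ⟨fun k hk t ht => ?_, fun k hk K => ?_, fun k hk ξ => ?_, fun k hk ξ t ht => ?_⟩
    · cases k with
      | zero => exact (base l).meas 0 le_rfl t ht
      | succ k => exact (hD_fam l).meas k (by omega) t ht
    · cases k with
      | zero => exact (base l).dom 0 le_rfl K
      | succ k => exact (hD_fam l).dom k (by omega) K
    · cases k with
      | zero => exact (base l).cont 0 le_rfl ξ
      | succ k => exact (hD_fam l).cont k (by omega) ξ
    · cases k with
      | zero =>
        have hd := h.hasDerivWithinAt_apply hc ha ξ ht l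
        simp only [consFamily_zero, consFamily_succ, zero_add]
        convert hd using 1
        simp only [hD, hW0, nonlinFamily_zero]
      | succ k =>
        simp only [consFamily_succ]
        exact (hD_fam l).deriv k (by omega) ξ t ht

/-- **Pressure families of all orders**: with `W` as in `exists_family`, the pressure symbol
family `presFamily W W` is a (pointwise-decaying) Fourier family of order `n` with zeroth member
`presSymbol (v t) (v t)`. [folklore] -/
theorem IsSobolevMild.exists_presFamily (h : IsSobolevMild c T a v) (hc : 0 ≤ c) (hT : 0 < T)
    (ha : IsSobolevFourierDatum a) (n : ℕ) :
    ∃ Q : ℕ → ℝ → EuclideanSpace ℝ ι → ℂ,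
      (∀ t ξ, Q 0 t ξ = presSymbol (v t) (v t) ξ) ∧ IsFourierFamily T n Q := by
  obtain ⟨W, hW0, hW⟩ := h.exists_family hc hT ha n
  refine ⟨presFamily W W, fun t ξ => ?_, IsDomFamily.presFamily hT hW hW⟩
  rw [presFamily_zero, hW0]

/-- **The nonlinearity along the solution has families of all orders** (pointwise decaying):
`nonlinFamily W W` with zeroth member `N(v t, v t)`. [folklore] -/
theorem IsSobolevMild.exists_nonlinFamily (h : IsSobolevMild c T a v) (hc : 0 ≤ c) (hT : 0 < T)
    (ha : IsSobolevFourierDatum a) (n : ℕ) :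
    ∃ M : ℕ → ℝ → EuclideanSpace ℝ ι → ι → ℂ,
      (∀ t ξ, M 0 t ξ = nonlin (v t) (v t) ξ) ∧
        ∀ l, IsFourierFamily T n (fun k t ξ => M k t ξ l) := by
  obtain ⟨W, hW0, hW⟩ := h.exists_family hc hT ha n
  refine ⟨nonlinFamily W W, fun t ξ => ?_, fun l => IsDomFamily.nonlinFamily hT hW hW l⟩
  rw [nonlinFamily_zero, hW0]

end Bootstrap

end Literature.Analysis.FluidPDE.FourierNS

end
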